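import Literature.Analysis.ValidatedNumerics.ParametricLyapunovCertificate
import HarnessLib

/-!
# Piecewise-Lyapunov certificates, part 2: point INSTABILITY witnesses and general SIMILARITY preconditioning

Topic `Literature/Analysis/ValidatedNumerics`. Sequel of `ParametricLyapunovCertificate.lean` (kd-trees of
Lyapunov leaves, `lyapTab`, `lyapLeafOK`, `re_le_neg_of_kdCheck_lyap(_shifted)`, diagonal similarity
`conjDiagTab`). Two additions used by the certnum S3 eigen-margin call (`hurwitz_margin`, design note
`run/shared/lean/pub/certnum/sdp/DESIGN-eigopt.md` §1 S3, v0.1.5):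

1. **Point instability witnesses** (`InstabCert`, `checkInstab`, `exists_re_nonneg_of_checkInstab`): the KERNEL
   form of the VIOLATED verdict. Data: the rational point matrix `J`, a rational symmetric `P` with a NEGATIVE
   direction (explicit rational `x`, `xᵀPx < 0`), and an `LDLCert` for `Q_P = −(JᵀP + PJ) ⪰ κ·1`, `κ > 0`. Claim:
   `J` has a complex eigenvalue with `Re μ ≥ 0`. Reason (Dym 2023, Lemma 37.7 — in the tree as
   `Literature.LinearAlgebra.Matrix.posDef_of_lyapunov_eq`): were `J` Hurwitz, the solution `X = P` of
   `JᴴX + XJ = −Q_P` with `Q_P ≻ O` would be positive definite, contradicting `xᵀPx < 0`. (At a MARGINAL point —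
   eigenvalues exactly on the axis — no such certificate exists; a producer then keeps an exact Routh–Hurwitz
   computation as its only witness.)
2. **General similarity preconditioning** (`mulTab`, `conjTab`, `isInvPairQ`, `re_le_neg_of_kdCheck_lyap_sim_shifted`):
   for lightly damped oscillatory families the centre-`P` certificates are ill-conditioned; conjugating by a rational
   approximation `T` of the modal matrix (with an EXACT rational inverse `Tinv`, `T·Tinv = 1 = Tinv·T` checked in
   the kernel) makes `Tinv·J(p)·T` nearly normal. The certificate for the conjugated tables transfers to `J(p)` by
   `spectrum.units_conjugate`, exactly as for the diagonal case of the parent file.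

Nothing here is new mathematics; it is certificate plumbing over the parent file, `LyapunovEquation.lean` /
`LyapunovDecayRate.lean` and Mathlib.

## What is NOT certified

Instability at marginal points (no witness of this form exists there); anything about time-varying systems; for the
similarity lemma, nothing unless `T·Tinv = 1 = Tinv·T` holds EXACTLY (checked).

## References

* [CarlsonSchneider1962] D. Carlson, H. Schneider, J. Math. Anal. Appl. 6 (1963) 430–446, § 1 (Lyapunov's theorem;
  the identity at an eigenvector) — as in the parent files. [cite: CarlsonSchneider1962, § 1]
* [Hladik2017] M. Hladík, arXiv:1704.05782 (2017), Thm. 7 — vertex property used by the leaf certificates.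
  [cite: Hladik2017, Thm. 7]
-/

open Finset Matrix

namespace Literature.Analysis.ValidatedNumerics

open ParametricIntervalPosSemidef ParametricEigenMargin

/-! ### Plumbing shared with the parent file (re-proved: the parent's copies are private) -/

/-- Entries of `finMat` (plumbing). [folklore] -/
private theorem finMat_apply₆ (n : ℕ) (A : List (List ℚ)) (i j : Fin n) :
    finMat n A i j = mreal A i j := rfl

/-- A symmetric table is a symmetric real matrix. [folklore] -/
private theorem isHermitian_finMat_of_symmQ₆ {n : ℕ} {A : List (List ℚ)} (h : symmQ n A = true) :
    (finMat n A).IsHermitian := by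
  refine Matrix.IsHermitian.ext fun i j ↦ ?_
  have h1 := of_rall (of_rall h j.isLt) i.isLt
  rw [decide_eq_true_eq] at h1
  rw [star_trivial, finMat_apply₆, finMat_apply₆]
  unfold mreal; rw [h1]

/-- Exact data: `|A i j − A i j| ≤ 0 = zeroTab i j`. [folklore] -/
private theorem abs_sub_self_le_zeroTab₆ {n : ℕ} (C : List (List ℚ)) (i j : Fin n) :
    |finMat n C i j - mreal C i j| ≤ mreal (zeroTab n) i j := by
  rw [finMat_apply₆, sub_self, abs_zero]
  unfold zeroTab mreal; rw [mget_mtab _ i.isLt j.isLt]; push_cast; exact le_rfl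

/-- The real Lyapunov form matrix `−(JᵀP + PJ)` (same as the parent's private `lyapR`). [cite: CarlsonSchneider1962, § 1] -/
private def lyapR₆ {n : ℕ} (J P : Matrix (Fin n) (Fin n) ℝ) : Matrix (Fin n) (Fin n) ℝ := -(Jᵀ * P + P * J)

/-- `finMat (lyapTab J P) = −((finMat J)ᵀ · finMat P + finMat P · finMat J)`. [folklore] -/
private theorem finMat_lyapTab₆ {n : ℕ} (J P : List (List ℚ)) :
    finMat n (lyapTab n J P) = lyapR₆ (finMat n J) (finMat n P) := by
  ext i j
  unfold lyapR₆
  rw [Matrix.neg_apply, Matrix.add_apply, Matrix.mul_apply, Matrix.mul_apply, finMat_apply₆]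
  unfold lyapTab mreal
  rw [mget_mtab _ i.isLt j.isLt, rsum_eq_sum]
  push_cast
  rw [← Fin.sum_univ_eq_sum_range (fun l ↦ ((mget J l i : ℚ) : ℝ) * ((mget P l j : ℚ) : ℝ)
    + ((mget P i l : ℚ) : ℝ) * ((mget J l j : ℚ) : ℝ)) n, Finset.sum_add_distrib]
  rfl


open scoped ComplexOrder

/-! ### Point INSTABILITY witnesses: `J` is NOT Hurwitz, from a Lyapunov-form certificate and a negative direction

Appended 2026-08-27 (session 3): the kernel form of the VIOLATED verdict of the S3 call. Data: the rational point
matrix `J`, a rational symmetric `P` with a NEGATIVE direction (an explicit rational `x` with `xᵀPx < 0`), and an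
`LDLCert` for `Q_P = −(JᵀP + PJ) ⪰ κ·1` with `κ > 0`. Claim (`exists_re_nonneg_of_checkInstab`): `J` has a
complex eigenvalue with `Re μ ≥ 0`. Reason (Dym's Lemma 37.7, in the tree as
`Literature.LinearAlgebra.Matrix.posDef_of_lyapunov_eq`): were `J` Hurwitz, the solution `X = P` of
`JᴴX + XJ = −Q_P` with `Q_P ≻ O` would be positive definite, contradicting `xᵀPx < 0`. (For a strictly unstable
`J` the producer obtains such a `P` from the float Lyapunov solve of `JᵀP + PJ = −1`; at a marginal point —
eigenvalues exactly on the axis — no such certificate exists and the producer's witness stays exact-arithmetic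
Routh–Hurwitz only.) -/

/-- The exact quadratic form `xᵀPx` of rational data (`n × n` block). [folklore] -/
def qformQ (n : ℕ) (P : List (List ℚ)) (x : List ℚ) : ℚ :=
  rsum n fun i ↦ rsum n fun j ↦ vget x i * mget P i j * vget x j

/-- An instability witness for a point matrix `J`: `P` symmetric with a negative direction `x`, and a
certificate `c` for `−(JᵀP + PJ) ⪰ c.lam·1`, `c.lam > 0`. [cite: CarlsonSchneider1962, § 1] -/
structure InstabCert where
  /-- the (indefinite) Lyapunov-form matrix -/
  P : List (List ℚ)
  /-- certificate for `Q_P = −(JᵀP + PJ) ⪰ c.lam · 1` (need `c.lam > 0`) -/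
  c : LDLCert
  /-- a rational vector with `xᵀPx < 0` -/
  x : List ℚ
  deriving Inhabited

/-- **The instability-witness checker**: `P` symmetric, `c.lam > 0`, `checkLower n (−(JᵀP+PJ)) 0 c`, and
`xᵀPx < 0` exactly. [cite: CarlsonSchneider1962, § 1] -/
def checkInstab (n : ℕ) (J : List (List ℚ)) (w : InstabCert) : Bool :=
  symmQ n w.P && decide (0 < w.c.lam) && checkLower n (lyapTab n J w.P) (zeroTab n) w.c &&
    decide (qformQ n w.P w.x < 0)

/-- `(M.map ofReal)ᴴ = Mᵀ.map ofReal` for a real matrix (plumbing). [folklore] -/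
private theorem conjTranspose_map_ofReal₅ {n : ℕ} (M : Matrix (Fin n) (Fin n) ℝ) :
    (M.map (algebraMap ℝ ℂ))ᴴ = Mᵀ.map (algebraMap ℝ ℂ) := by
  ext i j
  simp only [Matrix.conjTranspose_apply, Matrix.map_apply, Matrix.transpose_apply, Complex.coe_algebraMap,
    Complex.star_def, Complex.conj_ofReal]

/-- The complex form of a complexified real matrix at `z = u + iv` has real part `uᵀMu + vᵀMv`
(no symmetry needed). [folklore] -/
private theorem re_form_map_ofReal {n : ℕ} (S : Matrix (Fin n) (Fin n) ℝ) (z : Fin n → ℂ) :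
    (star z ⬝ᵥ ((S.map (algebraMap ℝ ℂ)) *ᵥ z)).re
      = (fun i ↦ (z i).re) ⬝ᵥ (S *ᵥ fun i ↦ (z i).re) + (fun i ↦ (z i).im) ⬝ᵥ (S *ᵥ fun i ↦ (z i).im) := by
  simp only [dotProduct, Matrix.mulVec, Matrix.map_apply, Complex.re_sum, Finset.mul_sum,
    ← Finset.sum_add_distrib]
  refine Finset.sum_congr rfl fun i _ ↦ Finset.sum_congr rfl fun j _ ↦ ?_
  simp only [Pi.star_apply, Complex.star_def, Complex.mul_re, Complex.conj_re, Complex.conj_im,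
    Complex.coe_algebraMap, Complex.ofReal_re, Complex.ofReal_im, zero_mul, sub_zero, Complex.mul_im, add_zero]
  ring

/-- For a Hermitian complex matrix the form `z*Mz` is real (plumbing). [folklore] -/
private theorem im_form_eq_zero_of_isHermitian {n : ℕ} {M : Matrix (Fin n) (Fin n) ℂ} (hM : M.IsHermitian)
    (z : Fin n → ℂ) : (star z ⬝ᵥ (M *ᵥ z)).im = 0 := by
  have h : star (star z ⬝ᵥ (M *ᵥ z)) = star z ⬝ᵥ (M *ᵥ z) := by
    conv_lhs => rw [← star_dotProduct, Matrix.star_mulVec, ← Matrix.dotProduct_mulVec, hM.eq]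
  exact Complex.conj_eq_iff_im.1 h

/-- The rational quadratic form is the real form of the cast data (plumbing). [folklore] -/
private theorem qformQ_cast {n : ℕ} (P : List (List ℚ)) (x : List ℚ) :
    ((qformQ n P x : ℚ) : ℝ) = (fun i : Fin n ↦ vreal x i) ⬝ᵥ (finMat n P *ᵥ fun i : Fin n ↦ vreal x i) := by
  unfold qformQ
  rw [rsum_eq_sum]; push_cast
  simp only [rsum_eq_sum]; push_cast
  rw [← Fin.sum_univ_eq_sum_range (fun i ↦ ∑ j ∈ Finset.range n,
      ((vget x i : ℚ) : ℝ) * ((mget P i j : ℚ) : ℝ) * ((vget x j : ℚ) : ℝ)) n]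
  simp only [dotProduct, Matrix.mulVec, Finset.mul_sum]
  refine Finset.sum_congr rfl fun i _ ↦ ?_
  rw [← Fin.sum_univ_eq_sum_range (fun j ↦ ((vget x i : ℚ) : ℝ) * ((mget P i j : ℚ) : ℝ) * ((vget x j : ℚ) : ℝ)) n]
  refine Finset.sum_congr rfl fun j _ ↦ ?_
  rw [finMat_apply₆]; unfold mreal vreal; ring

/-- **Instability witness (point matrix).** If `checkInstab n J w = true` then the real matrix `J` has a complex
eigenvalue with non-negative real part — `J` is NOT Hurwitz. (Were all `Re μ < 0`, Dym's Lemma 37.7 would make the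
solution `P` of `JᴴP + PJ = −Q_P`, `Q_P ≻ O`, positive definite, contradicting the certified negative direction.)
[cite: CarlsonSchneider1962, § 1; Hladik2017, Thm. 7] -/
theorem exists_re_nonneg_of_checkInstab {n : ℕ} {J : List (List ℚ)} {w : InstabCert}
    (h : checkInstab n J w = true) :
    ∃ μ ∈ spectrum ℂ ((finMat n J).map (algebraMap ℝ ℂ)), 0 ≤ μ.re := by
  unfold checkInstab at h
  simp only [Bool.and_eq_true, decide_eq_true_eq] at h
  obtain ⟨⟨⟨hsym, hκ⟩, hchk⟩, hq⟩ := h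
  by_contra hcon
  simp only [not_exists, not_and, not_le] at hcon
  -- real data
  set Jr : Matrix (Fin n) (Fin n) ℝ := finMat n J with hJr
  set Pr : Matrix (Fin n) (Fin n) ℝ := finMat n w.P with hPr
  have hPH : Pr.IsHermitian := isHermitian_finMat_of_symmQ₆ hsym
  have hPt : Prᵀ = Pr := by
    have := hPH.eq; rwa [Matrix.conjTranspose_eq_transpose_of_trivial] at this
  -- the certified Lyapunov form: κ·yᵀy ≤ yᵀ Q y with Q = −(JᵀP + PJ)
  have hQform : ∀ y : Fin n → ℝ, (w.c.lam : ℝ) * (y ⬝ᵥ y) ≤ y ⬝ᵥ (lyapR₆ Jr Pr *ᵥ y) := by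
    intro y
    have h1 := mul_dotProduct_le_of_checkLower hchk (A := finMat n (lyapTab n J w.P))
      (abs_sub_self_le_zeroTab₆ _) y
    rwa [finMat_lyapTab₆] at h1
  -- complexification
  set f := algebraMap ℝ ℂ
  set A : Matrix (Fin n) (Fin n) ℂ := Jr.map f with hA
  set X : Matrix (Fin n) (Fin n) ℂ := Pr.map f with hX
  set Qc : Matrix (Fin n) (Fin n) ℂ := (lyapR₆ Jr Pr).map f with hQc
  have hlyap : Aᴴ * X + X * A = -Qc := by
    have e1 : Aᴴ * X + X * A = (Jrᵀ * Pr + Pr * Jr).map f := by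
      rw [hA, hX, conjTranspose_map_ofReal₅, Matrix.map_add f (map_add f), Matrix.map_mul, Matrix.map_mul]
    rw [e1, hQc]
    unfold lyapR₆
    rw [Matrix.map_neg _ (map_neg f), neg_neg]
  -- Qc ≻ O (complex)
  have hQsym : (lyapR₆ Jr Pr)ᵀ = lyapR₆ Jr Pr := by
    unfold lyapR₆
    rw [Matrix.transpose_neg, Matrix.transpose_add, Matrix.transpose_mul, Matrix.transpose_mul,
      Matrix.transpose_transpose, hPt, add_comm]
  have hQcH : Qc.IsHermitian := by
    show Qcᴴ = Qc
    rw [hQc, conjTranspose_map_ofReal₅, hQsym]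
  have hQcpos : Qc.PosDef := by
    refine Matrix.PosDef.of_dotProduct_mulVec_pos hQcH fun z hz ↦ ?_
    have him := im_form_eq_zero_of_isHermitian hQcH z
    have hre : 0 < (star z ⬝ᵥ (Qc *ᵥ z)).re := by
      rw [hQc, re_form_map_ofReal]
      set u : Fin n → ℝ := fun i ↦ (z i).re
      set v : Fin n → ℝ := fun i ↦ (z i).im
      have hu := hQform u; have hv := hQform v
      have huu : 0 ≤ u ⬝ᵥ u := Finset.sum_nonneg fun i _ ↦ mul_self_nonneg _
      have hvv : 0 ≤ v ⬝ᵥ v := Finset.sum_nonneg fun i _ ↦ mul_self_nonneg _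
      -- z ≠ 0 ⇒ uᵀu + vᵀv > 0
      have hpos : 0 < u ⬝ᵥ u + v ⬝ᵥ v := by
        by_contra h0
        rw [not_lt] at h0
        apply hz; funext i
        have h1 : u ⬝ᵥ u = 0 := le_antisymm (by linarith) huu
        have h2 : v ⬝ᵥ v = 0 := le_antisymm (by linarith) hvv
        have hui : u i = 0 := by
          have := (Finset.sum_eq_zero_iff_of_nonneg fun j _ ↦ mul_self_nonneg (u j)).1 h1 i (Finset.mem_univ i)
          exact mul_self_eq_zero.1 this
        have hvi : v i = 0 := by
          have := (Finset.sum_eq_zero_iff_of_nonneg fun j _ ↦ mul_self_nonneg (v j)).1 h2 i (Finset.mem_univ i)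
          exact mul_self_eq_zero.1 this
        exact Complex.ext hui hvi
      have hκ' : (0 : ℝ) < w.c.lam := by exact_mod_cast hκ
      nlinarith [mul_pos hκ' hpos]
    rw [Complex.lt_def]
    exact ⟨by simpa using hre, by simp [him]⟩
  -- Dym's Lemma 37.7: A Hurwitz and AᴴX + XA = −Qc with Qc ≻ O ⇒ X ≻ O
  have hXpos : X.PosDef := by
    refine Literature.LinearAlgebra.Matrix.posDef_of_lyapunov_eq hcon ?_ hlyap
    rw [neg_neg]; exact hQcpos
  -- contradiction with the negative direction
  let xr : Fin n → ℝ := fun i ↦ vreal w.x i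
  have hneg : xr ⬝ᵥ (Pr *ᵥ xr) < 0 := by
    have := qformQ_cast (n := n) w.P w.x
    have hq' : ((qformQ n w.P w.x : ℚ) : ℝ) < 0 := by exact_mod_cast hq
    rw [this] at hq'; exact hq'
  have hnn := hXpos.posSemidef.dotProduct_mulVec_nonneg (fun i ↦ ((xr i : ℝ) : ℂ))
  rw [Complex.le_def] at hnn
  have hre := hnn.1
  rw [Complex.zero_re, hX, re_form_map_ofReal] at hre
  simp only [Complex.ofReal_re, Complex.ofReal_im] at hre
  have hz : (fun i : Fin n ↦ (0 : ℝ)) ⬝ᵥ (Pr *ᵥ fun i : Fin n ↦ (0 : ℝ)) = 0 := by simp [dotProduct]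
  rw [hz, add_zero] at hre
  exact absurd hneg (not_lt.2 hre)

/-- Kernel example: `J = [[1, 0], [0, −1]]` (eigenvalue `+1`), `P = diag(−1/2, 1/2)`: `−(JᵀP + PJ) = I ⪰ 1·1`,
`x = e₁` with `xᵀPx = −1/2 < 0` ⇒ `J` is not Hurwitz. -/
example : checkInstab 2 [[1, 0], [0, -1]] ⟨[[-1/2, 0], [0, 1/2]], ⟨1, 0, [], []⟩, [1, 0]⟩ = true := by
  decide +kernel


/-! ### General similarity preconditioning: certifying `J(p)` through `T⁻¹·J(p)·T` for a rational pair `(T, T⁻¹)`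

Appended 2026-08-27 (session 3): lightly damped oscillatory families make the centre-`P` certificates
ill-conditioned; conjugating by a rational approximation `T` of the (real) modal matrix makes `T⁻¹J(p)T` nearly
normal, so `P ≈ 1` works on large leaves. The kernel checks `T·Tinv = 1 = Tinv·T` exactly (`isInvPairQ`) and the
certificate for the conjugated tables transfers to `J(p)` by `spectrum.units_conjugate`. -/

/-- Exact product of rational tables (`n × n` block). [folklore] -/
def mulTab (n : ℕ) (A B : List (List ℚ)) : List (List ℚ) :=
  mtab n n fun i j ↦ rsum n fun l ↦ mget A i l * mget B l j

/-- The conjugated table `Tinv · J · T`. [folklore] -/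
def conjTab (n : ℕ) (T Tinv J : List (List ℚ)) : List (List ℚ) := mulTab n (mulTab n Tinv J) T

/-- `T · Tinv = 1` and `Tinv · T = 1` exactly (entrywise on the `n × n` block). [folklore] -/
def isInvPairQ (n : ℕ) (T Tinv : List (List ℚ)) : Bool :=
  (rall n fun i ↦ rall n fun j ↦ decide (mget (mulTab n T Tinv) i j = if i = j then 1 else 0)) &&
    rall n fun i ↦ rall n fun j ↦ decide (mget (mulTab n Tinv T) i j = if i = j then 1 else 0)

/-- `finMat (A·B) = finMat A · finMat B`. [folklore] -/
private theorem finMat_mulTab {n : ℕ} (A B : List (List ℚ)) : finMat n (mulTab n A B) = finMat n A * finMat n B := by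
  ext i j
  rw [Matrix.mul_apply, finMat_apply₆]
  unfold mulTab mreal
  rw [mget_mtab _ i.isLt j.isLt, rsum_eq_sum]
  push_cast
  rw [← Fin.sum_univ_eq_sum_range (fun l ↦ ((mget A i l : ℚ) : ℝ) * ((mget B l j : ℚ) : ℝ)) n]
  rfl

/-- From `isInvPairQ`: the real matrices are inverse to each other. [folklore] -/
private theorem finMat_mul_eq_one_of_isInvPairQ {n : ℕ} {T Tinv : List (List ℚ)} (h : isInvPairQ n T Tinv = true) :
    finMat n T * finMat n Tinv = 1 ∧ finMat n Tinv * finMat n T = 1 := by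
  unfold isInvPairQ at h
  rw [Bool.and_eq_true] at h
  obtain ⟨h1, h2⟩ := h
  constructor
  · rw [← finMat_mulTab]; ext i j
    have e := of_rall (of_rall h1 i.isLt) j.isLt; rw [decide_eq_true_eq] at e
    rw [finMat_apply₆, Matrix.one_apply]; unfold mreal; rw [e]
    by_cases hij : i = j
    · subst hij; simp
    · have : (i : ℕ) ≠ (j : ℕ) := fun c ↦ hij (Fin.ext c)
      simp [hij, this]
  · rw [← finMat_mulTab]; ext i j
    have e := of_rall (of_rall h2 i.isLt) j.isLt; rw [decide_eq_true_eq] at e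
    rw [finMat_apply₆, Matrix.one_apply]; unfold mreal; rw [e]
    by_cases hij : i = j
    · subst hij; simp
    · have : (i : ℕ) ≠ (j : ℕ) := fun c ↦ hij (Fin.ext c)
      simp [hij, this]

/-- The conjugated affine family is the conjugate of the original one: `Σ` commutes with `Tinv · (·) · T`. [folklore] -/
private theorem affine_conjTab_eq {n K : ℕ} (T Tinv : List (List ℚ)) (J0 : List (List ℚ)) (Js : List (List (List ℚ)))
    (x : ℕ → ℝ) :
    finMat n (conjTab n T Tinv J0)
        + paramMatrix (fun k : Fin K ↦ finMat n ((vtab K fun k ↦ conjTab n T Tinv (Js.getD k [])).getD k [])) (fun k : Fin K ↦ x k)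
      = finMat n Tinv * (finMat n J0 + paramMatrix (fun k : Fin K ↦ finMat n (Js.getD k [])) (fun k : Fin K ↦ x k)) * finMat n T := by
  have h2 : ∀ k : Fin K, (vtab K fun k ↦ conjTab n T Tinv (Js.getD k [])).getD k [] = conjTab n T Tinv (Js.getD k []) :=
    fun k ↦ by
      show ((List.range K).map fun k ↦ conjTab n T Tinv (Js.getD k [])).getD k [] = _
      rw [List.getD_eq_getElem (l := (List.range K).map _) (d := []) (by simp [k.isLt]), List.getElem_map, List.getElem_range]
  simp only [h2]
  simp only [conjTab, finMat_mulTab]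
  unfold paramMatrix
  rw [Matrix.mul_add, Matrix.add_mul, Matrix.mul_sum, Matrix.sum_mul]
  congr 1
  refine Finset.sum_congr rfl fun k _ ↦ ?_
  simp only [Matrix.mul_smul, Matrix.smul_mul, Matrix.mul_assoc]

/-- **Similarity-preconditioned + shifted piecewise-Lyapunov certificate ⇒ rate bound for the ORIGINAL family.** If
`T·Tinv = 1 = Tinv·T` exactly and the kd-tree checks for the tables `(Tinv J₀ T + s·1, Tinv J^{(k)} T)` with rate `r`,
then every eigenvalue `μ` of `J(x) = J₀ + Σ x_k J^{(k)}`, `x` in the box, has `Re μ ≤ −(s + r)`.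
[cite: CarlsonSchneider1962, § 1; Hladik2017, Thm. 7] -/
theorem re_le_neg_of_kdCheck_lyap_sim_shifted {n K : ℕ} {J0 : List (List ℚ)} {Js : List (List (List ℚ))}
    {T Tinv : List (List ℚ)} {s r : ℚ} {B : Box} {t : KdCert LyapLeaf} (hT : isInvPairQ n T Tinv = true)
    (h : t.check (lyapLeafOK n K (addDiagTab n s (conjTab n T Tinv J0))
      (vtab K fun k ↦ conjTab n T Tinv (Js.getD k [])) r) B = true)
    (x : ℕ → ℝ) (hx : B.mem x) {μ : ℂ}
    (hμ : μ ∈ spectrum ℂ ((finMat n J0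
      + paramMatrix (fun k : Fin K ↦ finMat n (Js.getD k [])) (fun k : Fin K ↦ x k)).map (algebraMap ℝ ℂ))) :
    μ.re ≤ -((s + r : ℚ) : ℝ) := by
  set M : Matrix (Fin n) (Fin n) ℝ :=
    finMat n J0 + paramMatrix (fun k : Fin K ↦ finMat n (Js.getD k [])) (fun k : Fin K ↦ x k) with hM
  obtain ⟨hTT, hTiT⟩ := finMat_mul_eq_one_of_isInvPairQ hT
  set f := algebraMap ℝ ℂ
  -- the complex unit u = Tinv.map with inverse T.map
  let u : (Matrix (Fin n) (Fin n) ℂ)ˣ :=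
    ⟨(finMat n Tinv).map f, (finMat n T).map f,
      by rw [← Matrix.map_mul, hTiT, Matrix.map_one f (map_zero f) (map_one f)],
      by rw [← Matrix.map_mul, hTT, Matrix.map_one f (map_zero f) (map_one f)]⟩
  have hconj : (finMat n (conjTab n T Tinv J0)
        + paramMatrix (fun k : Fin K ↦ finMat n ((vtab K fun k ↦ conjTab n T Tinv (Js.getD k [])).getD k []))
            (fun k : Fin K ↦ x k)).map f
      = (u : Matrix (Fin n) (Fin n) ℂ) * M.map f * (u⁻¹ : (Matrix (Fin n) (Fin n) ℂ)ˣ) := by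
    rw [affine_conjTab_eq, ← hM, Matrix.map_mul, Matrix.map_mul]; rfl
  have hμ' : μ ∈ spectrum ℂ ((finMat n (conjTab n T Tinv J0)
        + paramMatrix (fun k : Fin K ↦ finMat n ((vtab K fun k ↦ conjTab n T Tinv (Js.getD k [])).getD k []))
            (fun k : Fin K ↦ x k)).map f) := by
    rw [hconj, spectrum.units_conjugate]; exact hμ
  exact re_le_neg_of_kdCheck_lyap_shifted h x hx hμ'

/-- Kernel example (similarity): `J = [[0, 2], [−8, −2]]` (eigenvalues `−1 ± i√15`), `T = diag(1, 2)`, `Tinv = diag(1, 1/2)`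
(exact inverse pair), ONE leaf with `P = I`: `Tinv·J·T = [[0, 4], [−4, −2]]` has symmetric part `diag(0, −2)` — so
this toy does not certify Hurwitz with `P = I`; the example only exercises `isInvPairQ` in the kernel. -/
example : isInvPairQ 2 [[1, 0], [0, 2]] [[1, 0], [0, 1/2]] = true := by
  decide +kernel

end Literature.Analysis.ValidatedNumerics
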